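import Mathlib
import HarnessLib
import Summits.HubbardSuperconductivity.HubbardSuperconductivity.Theorems.KLProgrammeKLRegimeTwoVolumeFarStep
import Literature.MathematicalPhysics.QuantumLattice.GrassmannDefectSplit

/-!
# Route `KLProgramme` — crux K3, the nested two-volume pass at scale 0 (gen-6 engine item stmt-HubbardSuperconductivity-20236, the `TwoLegVolumeRateAT`
# conjunct of `TwoLegStepV16 … 0` in `stub_twoLeg_scale0`; VL item 20239 (N)): THE DEFECT-COVARIANCE STEP ASSEMBLED — one flat statement
# (cell gate-hubbard-kl, seat hubbard-kl-k3c5-p2 g5; mechanism β′ «semigroup defect», BETA-PRIME-ROADMAP.md)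

The four abstract pieces of the β′ chain composed into ONE theorem whose hypotheses are exactly the model-level deliverables (m2)–(m4) of the roadmap:
for `C' = C + D_n + D_f` on one Grassmann algebra, an even input `V` without constant part, `W := effAction C V`, `W₁ := effAction D_f W`,

* `D_n` replica-Gram-bounded (`κn`) with row/column sums `≤ αn` and entries `≤ sn` (the NEAR defect: `αn, sn = O(m₁/L)`), and an all-degree pinned profile `Nn`
  of `W₁` with the single-scale smallness `e·αn·‖W₁‖_h/κn² < 1`  ⟶ `GrassmannNearIdentityStep`;
* `D_f` with a charged Gram FORM (`q, f, g, κf`), supported on `Zs × Zs`, entries `≤ sD`, row/column sums `≤ αf`, the pin value `w` at distance `≥ R` from `Zs`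
  (`R ≤ d X` on `Zs`), an even-degree pinned profile `Nf` of `W` with `e·αf·‖W‖_h/κf² < 1` (⟶ `Z(s•D_f, W) ≠ 0`, `effPartitionFn_smul_isUnit_of_gram`) and,
  uniformly in `s ∈ [0,1]`, leg-`0` profiles `nV` and `d`-first moments `mV`, `mL` of `𝒱_s := effAction (s•D_f) W`  ⟶ `…TwoVolumeFarStep`;

then in every degree `n+1`, at the pin `w`,
`Σ_{X : X_p = w} ‖kernel (effAction C' V) (n+1) X − kernel (effAction C V) (n+1) X‖ ≤ NEAR(n+1) + FAR(n+1)`  (`GrassmannDefectSplit`).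

* **`sum_norm_kernel_twoVolumeDefect_le`** — the statement above.

Sorry-free; no definition; nothing is asserted about the model (the model-level instantiation = roadmap (m1)–(m5)).
-/

noncomputable section

namespace Summit.HubbardSuperconductivity.HubbardSuperconductivity.Theorems.TwoVolumeDefect

set_option linter.dupNamespace false -- summit = problem name (single-conjunct summit), D-0017

open Finset Literature.MathematicalPhysics.QuantumLattice GrassmannAlgebra Literature.Probability.LatticeModels
open scoped Nat InnerProductSpace

variable {𝕜 : Type*} [RCLike 𝕜] {Γ : Type} [LinearOrder Γ] [Fintype Γ]

/-- **THE DEFECT-COVARIANCE STEP, ASSEMBLED** (β′ chain: `GrassmannDefectSplit` ∘ `GrassmannNearIdentityStep` ∘ `…TwoVolumeFarStep`; see the module docstring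
for the reading of the hypotheses). [folklore; BGM 2006 (2.13)–(2.14), (2.86)–(2.90); Salmhofer 1998 §3.1/§4.1] -/
theorem sum_norm_kernel_twoVolumeDefect_le {E : Type*} [NormedAddCommGroup E] [InnerProductSpace 𝕜 E]
    (C Dn Df : Matrix Γ Γ 𝕜) (V : GrassmannAlgebra 𝕜 Γ) (hVe : V ∈ evenPart 𝕜 Γ) (hV0 : constPart 𝕜 V = 0)
    (hZC : IsUnit (effPartitionFn 𝕜 C V))
    -- FAR defect `Df`: Gram form, support, sizes, distance
    (q : Γ → Bool) (hq : ∀ X Y, q X = q Y → Df X Y = 0) (f g : Γ → E) {κf : ℝ} (hκf : 0 < κf)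
    (hf : ∀ X, q X = true → ‖f X‖ ≤ κf) (hg : ∀ Y, q Y = false → ‖g Y‖ ≤ κf)
    (hG : ∀ X Y, q X = true → q Y = false → contr 𝕜 Df X Y = ⟪f X, g Y⟫_𝕜)
    {Zs : Set Γ} [DecidablePred (· ∈ Zs)] (hfar : ∀ X Y, ¬ (X ∈ Zs ∧ Y ∈ Zs) → Df X Y = 0)
    {sD : ℝ} (hsD0 : 0 ≤ sD) (hsD : ∀ X Y, ‖Df X Y‖ ≤ sD)
    {αf : ℝ} (hαf : 0 < αf) (hfrow : ∀ X, ∑ Y, ‖Df X Y‖ ≤ αf) (hfcol : ∀ Y, ∑ X, ‖Df X Y‖ ≤ αf)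
    (d : Γ → ℝ) (hd0 : ∀ X, 0 ≤ d X) {R : ℝ} (hRpos : 0 < R) (hdR : ∀ X, X ∈ Zs → R ≤ d X) (w : Γ)
    -- profile of `W := effAction C V` (even degrees) and the single-scale smallness at `Df`
    (Nf : ℕ → ℝ) (hNf0 : ∀ m', 0 ≤ Nf m')
    (hNf : ∀ m' (j : Fin (2 * m')) (x : Γ), ∑ Y ∈ univ.filter (fun Y : Fin (2 * m') → Γ => Y j = x), ‖kernel 𝕜 (effAction 𝕜 C V) (2 * m') Y‖ ≤ Nf m')
    {ρf : ℝ} (hρf : 0 < ρf) (hθf : Real.exp 1 * αf * normV Γ κf ρf Nf / κf ^ 2 < 1)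
    -- uniform-in-`s` kernel data of `𝒱_s := effAction (s•Df) W`
    (nV mV mL : ℕ → ℝ) (hnV : ∀ m, 0 ≤ nV m) (hmV : ∀ m, 0 ≤ mV m)
    (hVs0 : ∀ s ∈ Set.Icc (0 : ℝ) 1, ∀ (m : ℕ) (x : Γ),
      ∑ U ∈ univ.filter (fun U : Fin (m + 1) → Γ => U 0 = x), ‖kernel 𝕜 (effAction 𝕜 (s • Df) (effAction 𝕜 C V)) (m + 1) U‖ ≤ nV (m + 1))
    (hVsm : ∀ s ∈ Set.Icc (0 : ℝ) 1, ∀ (m : ℕ) (i : Fin m),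
      ∑ U ∈ univ.filter (fun U : Fin (m + 1) → Γ => U i.succ = w),
        d (U 0) * ‖kernel 𝕜 (effAction 𝕜 (s • Df) (effAction 𝕜 C V)) (m + 1) U‖ ≤ mV (m + 1))
    (n : ℕ) (p : Fin (n + 1))
    (hVsL : ∀ s ∈ Set.Icc (0 : ℝ) 1,
      ∑ Z ∈ univ.filter (fun Z : Fin (n + 1 + 1 + 1) → Γ => Z (Fin.castSucc (Fin.castSucc p)) = w),
        d (Z (Fin.last (n + 1 + 1))) * ‖kernel 𝕜 (effAction 𝕜 (s • Df) (effAction 𝕜 C V)) (n + 1 + 2) Z‖ ≤ mL (n + 3))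
    -- NEAR defect `Dn`: Gram bound, sizes, profile of `W₁ := effAction Df W` (all degrees), smallness
    {κn : ℝ} (hκn : 0 < κn) (hGBn : IsGramBoundedR Dn κn)
    {αn : ℝ} (hαn : 0 < αn) (hnrow : ∀ X, ∑ Y, ‖Dn X Y‖ ≤ αn) (hncol : ∀ Y, ∑ X, ‖Dn X Y‖ ≤ αn)
    {sn : ℝ} (hsn : ∀ A B, ‖Dn A B‖ ≤ sn)
    (Nn : ℕ → ℝ) (hNn0 : ∀ m, 0 ≤ Nn m)
    (hNn : ∀ (m : ℕ) (j : Fin m) (x : Γ), ∑ Z ∈ univ.filter (fun Z : Fin m → Γ => Z j = x),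
      ‖kernel 𝕜 (effAction 𝕜 Df (effAction 𝕜 C V)) m Z‖ ≤ Nn m)
    {ρn : ℝ} (hρn : 0 < ρn) (hθn : Real.exp 1 * αn * normV Γ κn ρn (fun m' => Nn (2 * m')) / κn ^ 2 < 1)
    {k : ℕ} (hk : grassmannLaplacian 𝕜 Dn ^ k = 0) :
    ∑ X ∈ univ.filter (fun X : Fin (n + 1) → Γ => X p = w),
        ‖kernel 𝕜 (effAction 𝕜 (C + Dn + Df) V) (n + 1) X - kernel 𝕜 (effAction 𝕜 C V) (n + 1) X‖ ≤
      (∑ j ∈ Ico 1 k, ((n + 1 + 2 * j)! : ℝ) / (((n + 1) ! : ℝ) * (j ! : ℝ) * 2 ^ j) * sn ^ j * Nn (n + 1 + 2 * j) +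
          ρn⁻¹ ^ (n + 1) * (Real.exp 1 * normV Γ κn ρn (fun m' => Nn (2 * m'))) *
            (Real.exp 1 * αn * normV Γ κn ρn (fun m' => Nn (2 * m')) / κn ^ 2) /
              (1 - Real.exp 1 * αn * normV Γ κn ρn (fun m' => Nn (2 * m')) / κn ^ 2)) +
        ((((n + 1 + 1) * (n + 1 + 2) : ℕ) : ℝ) / 2 * (sD / R) * mL (n + 3) +
          ‖(2 : 𝕜)⁻¹‖ * ∑ a ∈ range (n + 2), ∑ b ∈ range (n + 2),
            (if a + b = n + 1 then (((a + 1) * (b + 1) : ℕ) : ℝ) *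
              (αf * (mV (a + 1) / R) * nV (b + 1) + αf * nV (a + 1) * (mV (b + 1) / R)) else 0)) := by
  classical
  set W : GrassmannAlgebra 𝕜 Γ := effAction 𝕜 C V with hW
  have hWe : W ∈ evenPart 𝕜 Γ := effAction_mem_evenPart C hVe hV0
  have hW0 : constPart 𝕜 W = 0 := constPart_effAction 𝕜 C V hZC
  -- the far partition functions along the path are units; in particular at `s = 1`
  have hZs : ∀ s ∈ Set.Icc (0 : ℝ) 1, effPartitionFn 𝕜 (s • Df) W ≠ 0 := fun s hs =>
    effPartitionFn_smul_isUnit_of_gram Df q hq f g hκf hf hg hG W hWe hW0 Nf hNf0 hNf hαf hfrow hfcol hρf hθf hs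
  have hZf : IsUnit (effPartitionFn 𝕜 Df W) := by
    have h := hZs 1 ⟨zero_le_one, le_rfl⟩
    rw [one_smul] at h
    exact isUnit_iff_ne_zero.2 h
  -- FAR bracket
  have hfarB := sum_norm_kernel_effAction_sub_self_le_of_far Df W hW0 (mem_evenPart_iff.1 hWe) hZs hfar hsD0 hsD hαf.le hαf.le
    hfrow hfcol d hd0 hRpos hdR w nV mV mL hnV hmV hVs0 hVsm n p hVsL
  -- NEAR bracket on `W₁ := effAction Df W`
  set W₁ : GrassmannAlgebra 𝕜 Γ := effAction 𝕜 Df W with hW₁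
  have hW₁e : W₁ ∈ evenPart 𝕜 Γ := effAction_mem_evenPart Df hWe hW0
  have hW₁0 : constPart 𝕜 W₁ = 0 := constPart_effAction 𝕜 Df W hZf
  have hnearB := (sum_norm_kernel_effAction_sub_self_le_of_gramBounded Dn hκn hGBn W₁ hW₁e hW₁0 Nn hNn0 hNn hαn hnrow hncol hρn hθn hsn hk).2
    (Nat.succ_pos n) p w
  exact sum_norm_kernel_effAction_defect_le_of_split 𝕜 C Dn Df V hZC hZf _ hnearB hfarB

end Summit.HubbardSuperconductivity.HubbardSuperconductivity.Theorems.TwoVolumeDefect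

end
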